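import Mathlib
import Summits.NavierStokesRegularity.NavierStokesRegularity.Theorems.LerayQuarterDissipationFiniteDissipationLiouvilleCrossFlowScaling
import HarnessLib

/-!
# Crux `FiniteDissipationLiouville` (stmt-NavierStokesRegularity-22144): THE CROSS-FLOW THRESHOLD ONE
# IS NOT ATTAINED — every enveloped Type-I ancient mild field whose velocity across the vorticity
# never exceeds the self-similar speed vanishes (law-free; `θ ≤ 1` instead of the tree's `θ < 1`)

Theorems file of route `LerayQuarterDissipation` (lead prover g17; `--supports` the crux; sequel of
`…CrossFlowRigidity` / `…CrossFlowDss`). Navier–Stokes regularity is NOT proved by anything here; no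
summit is.

The tree's law-free cross-flow threshold (pub-ns-dss, `…SimilarityEnstrophy.typeI_ancient_eq_zero_of_crossFlow_lt_one`):
`√(−t)‖ω × u‖ ≤ θ‖ω‖` everywhere with `θ < 1` forces an enveloped KNSS-gauge Type-I field to
vanish. This file settles the ENDPOINT `θ = 1` by a compactness (zoom-out) argument on top of the
monotone budget of `…CrossFlowDss` and the half-Beltrami rigidity of `…CrossFlowRigidity`:

* `lerayOrbit_nsRescale`, `enstrophy_nsRescale` — the Leray orbit of the rescaling `V_c` is the
  shifted orbit, `U_{V_c}(s) = U_V(s − 2 log c)`, so `Z_{V_c}(s) = Z_V(s − 2 log c)`;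
* `crossFlow_nsRescale`, `crossFlow_sim_of_phys` — the hypothesis is scale invariant / its
  similarity form;
* `tendsto_integral_sq_norm_curl_neg_one` — the enstrophy of the slice `t = −1` is continuous along
  sequences of the enveloped class with pointwise convergent gradients (dominated convergence under
  the class-uniform gauge bound `(‖x‖+1)²‖DV(−1,x)‖ ≤ K₁`);
* **`eq_zero_of_crossFlow_le_one`** — **a KNSS-gauge Type-I ancient mild field `V` with a Type-I
  envelope (same constant) and `√(−t)‖curl V(t,x) × V(t,x)‖ ≤ ‖curl V(t,x)‖` for all `t < 0`, `x`
  vanishes identically.** Proof: `Z_V` is non-increasing (`…CrossFlowDss`) and bounded, so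
  `Z_V(s) ↑ m` as `s → −∞`; the zoom-out sequence `V_{e^j}` has a KNSS limit `W`
  (`…Compactness.seqLimit`, gradients converge) in the same enveloped class with cross-flow `≤ 1`,
  and `Z_W ≡ m` (every slice of `W` is a limit of slices of `V` receding to `s → −∞`); a constant
  enstrophy is periodic, so `W ≡ 0` (`…CrossFlowDss.eq_zero_of_crossFlow_le_one_of_enstrophy_periodic`),
  `m = 0`, `Z_V ≡ 0`, `V ≡ 0`;
* `not_singular_of_crossFlow_le_one`, `crossFlow_exceeds_of_singular` — regularity form and
  PORTRAIT: a singular member of the stratum with the envelope has, somewhere, velocity across the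
  vorticity STRICTLY FASTER than the self-similar speed: `‖ω(t,x)‖ < √(−t)‖ω(t,x) × W(t,x)‖`.

HONEST FRAMING. An endpoint improvement (`θ < 1` ⇒ `θ ≤ 1`) of a law-free threshold row about a
HYPOTHETICAL object; no collar `1 + ε` is claimed (the compactness step here is qualitative).
Nothing is removed from the catalogued DSS wall beyond this sub-class; verdict of the line unchanged
(FRONTIER). Nothing here bears on Navier–Stokes regularity or blow-up.

References: Koch–Nadirashvili–Seregin–Šverák, Acta Math. 203 (2009) §4 (compactness of the class);
Bradshaw–Tsai, Comm. PDE 42 (2017) §5; Chae–Wolf, arXiv:1610.09464 §4; folklore energy method.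
-/

noncomputable section

set_option linter.dupNamespace false

namespace Summit.NavierStokesRegularity.NavierStokesRegularity.Theorems.FiniteDissipationLiouville.CrossFlow

open MeasureTheory Set Filter Topology Metric InnerProductSpace Function Real
open scoped RealInnerProductSpace ContDiff
open Literature.Analysis Literature.Analysis.FluidPDE
open Summit.NavierStokesRegularity.NavierStokesRegularity.Theorems
open Summit.NavierStokesRegularity.NavierStokesRegularity.Theorems.GaussianGap
open Summit.NavierStokesRegularity.NavierStokesRegularity.Theorems.SimilarityEnstrophy
open Summit.NavierStokesRegularity.NavierStokesRegularity.Theorems.SmallDissipationGap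
open Summit.NavierStokesRegularity.NavierStokesRegularity.Theorems.RecurrentReductionD
open Summit.NavierStokesRegularity.NavierStokesRegularity.Theorems.FiniteDissipationLiouville

variable {C : ℝ} {V : ℝ → EuclideanSpace ℝ (Fin 3) → EuclideanSpace ℝ (Fin 3)}

/-! ### The threshold is not attained -/

section Threshold

/-- **THE CROSS-FLOW THRESHOLD ONE IS NOT ATTAINED (law-free).** A KNSS-gauge Type-I ancient mild
field `V` (`IsTypeIAncientMild C V`) with a Type-I envelope `HasTypeIDecay C V` whose velocity
component across the vorticity never exceeds the self-similar speed,
`√(−t)‖curl V(t,x) × V(t,x)‖ ≤ ‖curl V(t,x)‖` for all `t < 0`, `x`, vanishes identically on `t < 0`.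
[folklore energy method + KNSS compactness] -/
theorem eq_zero_of_crossFlow_le_one (hV : IsTypeIAncientMild C V) (hdec : HasTypeIDecay C V)
    (hX : ∀ t < 0, ∀ x, Real.sqrt (-t) * ‖cross (curl (V t) x) (V t x)‖ ≤ ‖curl (V t) x‖) :
    ∀ t < 0, ∀ x, V t x = 0 := by
  obtain ⟨C₁, C₂, C₃, hD1, hD2, -⟩ := IsTypeIAncientMild.gaugeBounds_of_hasTypeIDecay hV hdec
  have hXs := crossFlow_sim_of_phys hX
  -- the global similarity enstrophy: antitone and bounded, hence convergent at `−∞`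
  obtain ⟨Z, hZdef⟩ : ∃ Z : ℝ → ℝ, Z = fun σ => ∫ y, ‖lerayVorticity V σ y‖ ^ 2 := ⟨_, rfl⟩
  have hZσ : ∀ σ, Z σ = ∫ y, ‖lerayVorticity V σ y‖ ^ 2 := fun σ => by rw [hZdef]
  have hanti : Antitone Z := by rw [hZdef]; exact antitone_enstrophy_of_crossFlow_le_one hV hdec hXs
  have hZ0 : ∀ σ, 0 ≤ Z σ := fun σ => by rw [hZσ]; exact integral_nonneg fun y => sq_nonneg _
  have hcontB : Continuous fun y : EuclideanSpace ℝ (Fin 3) =>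
      (‖curlCLM‖ * C₁) ^ 2 * (1 + ‖y‖) ^ (-(4 : ℝ)) :=
    continuous_const.mul ((continuous_const.add continuous_norm).rpow_const
      fun y => Or.inl (add_pos_of_pos_of_nonneg one_pos (norm_nonneg y)).ne')
  have imaj : Integrable fun y : EuclideanSpace ℝ (Fin 3) =>
      (‖curlCLM‖ * C₁) ^ 2 * (1 + ‖y‖) ^ (-(4 : ℝ)) :=
    integrable_of_le_decay_four hcontB (K := (‖curlCLM‖ * C₁) ^ 2) fun y => by
      rw [Real.norm_of_nonneg (by positivity)]
  have hbdd : BddAbove (range Z) := by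
    refine ⟨∫ y : EuclideanSpace ℝ (Fin 3), (‖curlCLM‖ * C₁) ^ 2 * (1 + ‖y‖) ^ (-(4 : ℝ)), ?_⟩
    rintro _ ⟨σ, rfl⟩
    rw [hZσ]
    refine integral_mono (integrable_norm_lerayVorticity_sq hV hD1 σ) imaj fun y => ?_
    have h := norm_lerayVorticity_le_decay hV hD1 σ y
    calc ‖lerayVorticity V σ y‖ ^ 2 ≤ (‖curlCLM‖ * C₁ * (1 + ‖y‖) ^ (-(2 : ℝ))) ^ 2 :=
          pow_le_pow_left₀ (norm_nonneg _) h 2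
      _ = (‖curlCLM‖ * C₁) ^ 2 * ((1 + ‖y‖) ^ (-(2 : ℝ)) * (1 + ‖y‖) ^ (-(2 : ℝ))) := by ring
      _ = (‖curlCLM‖ * C₁) ^ 2 * (1 + ‖y‖) ^ (-(4 : ℝ)) := by
          rw [← Real.rpow_add (by positivity)]; norm_num
  obtain ⟨m, hmdef⟩ : ∃ m : ℝ, m = ⨆ σ, Z σ := ⟨_, rfl⟩
  have hm : Tendsto Z atBot (𝓝 m) := by rw [hmdef]; exact tendsto_atBot_ciSup hanti hbdd
  -- the zoom-out sequence and its KNSS limit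
  obtain ⟨u, hudef⟩ : ∃ u : ℕ → ℝ → EuclideanSpace ℝ (Fin 3) → EuclideanSpace ℝ (Fin 3),
      ∀ j, u j = nsRescale (Real.exp j) V := ⟨_, fun j => rfl⟩
  have hu : ∀ j, IsTypeIAncientMild C (u j) := fun j => by
    rw [hudef]; exact hV.nsRescale (Real.exp_pos _)
  have hdu : ∀ j, HasTypeIDecay C (u j) := fun j => by
    rw [hudef]; exact hdec.nsRescale (Real.exp_pos _)
  obtain ⟨ψ, hψ, W, hW, -, hpt, hgr⟩ := Compactness.seqLimit hu
  have hψt : Tendsto (fun j => ((ψ j : ℕ) : ℝ)) atTop atTop :=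
    tendsto_natCast_atTop_atTop.comp hψ.tendsto_atTop
  -- the limit inherits the envelope and the cross-flow bound
  have hdW : HasTypeIDecay C W := fun t ht x =>
    le_of_tendsto (hpt t ht x).norm (Eventually.of_forall fun j => hdu (ψ j) t ht x)
  have hXu : ∀ j, ∀ t < 0, ∀ x, Real.sqrt (-t) * ‖cross (curl (u j t) x) (u j t x)‖ ≤ ‖curl (u j t) x‖ :=
    fun j => by rw [hudef]; exact crossFlow_nsRescale (Real.exp_pos _) hX
  have hXW : ∀ t < 0, ∀ x, Real.sqrt (-t) * ‖cross (curl (W t) x) (W t x)‖ ≤ ‖curl (W t) x‖ := by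
    intro t ht x
    -- opaque names for the two convergent sequences and their limits
    obtain ⟨A, hA⟩ : ∃ A : ℕ → EuclideanSpace ℝ (Fin 3), ∀ j, A j = curl (u (ψ j) t) x :=
      ⟨_, fun j => rfl⟩
    obtain ⟨B, hB⟩ : ∃ B : ℕ → EuclideanSpace ℝ (Fin 3), ∀ j, B j = u (ψ j) t x := ⟨_, fun j => rfl⟩
    obtain ⟨a, ha⟩ : ∃ a : EuclideanSpace ℝ (Fin 3), a = curl (W t) x := ⟨_, rfl⟩
    obtain ⟨b, hb⟩ : ∃ b : EuclideanSpace ℝ (Fin 3), b = W t x := ⟨_, rfl⟩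
    have hc : Tendsto A atTop (𝓝 a) := by
      have h := (curlCLM.continuous.tendsto _).comp (hgr t ht x)
      rw [ha, curl_eq_curlCLM]
      refine h.congr fun j => ?_
      rw [hA, curl_eq_curlCLM]; rfl
    have hvb : Tendsto B atTop (𝓝 b) := by
      rw [hb]; exact (hpt t ht x).congr fun j => (hB j).symm
    -- `cross (A j) (B j) → cross a b` by bilinearity (no product topology needed)
    have hcr : Tendsto (fun j => ‖cross (A j) (B j)‖) atTop (𝓝 ‖cross a b‖) := by
      have e : ∀ j, cross (A j) (B j) - cross a b = cross (A j - a) (B j) + cross a (B j - b) := by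
        intro j
        simp only [← crossCLM_apply, map_sub, sub_apply]
        abel
      have hbd : ∀ j, ‖cross (A j) (B j) - cross a b‖ ≤ ‖A j - a‖ * ‖B j‖ + ‖a‖ * ‖B j - b‖ := by
        intro j
        rw [e j]
        exact (norm_add_le _ _).trans (add_le_add (norm_cross_le_norm_mul_norm _ _)
          (norm_cross_le_norm_mul_norm _ _))
      have h1 : Tendsto (fun j => ‖A j - a‖) atTop (𝓝 0) := tendsto_iff_norm_sub_tendsto_zero.1 hc
      have h3 : Tendsto (fun j => ‖B j - b‖) atTop (𝓝 0) := tendsto_iff_norm_sub_tendsto_zero.1 hvb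
      have h0 : Tendsto (fun j => ‖A j - a‖ * ‖B j‖ + ‖a‖ * ‖B j - b‖) atTop (𝓝 0) := by
        have := (h1.mul hvb.norm).add (h3.const_mul ‖a‖)
        simpa using this
      have hdiff : Tendsto (fun j => cross (A j) (B j) - cross a b) atTop (𝓝 0) :=
        squeeze_zero_norm hbd h0
      exact (tendsto_sub_nhds_zero_iff.1 hdiff).norm
    have hle : ∀ j, Real.sqrt (-t) * ‖cross (A j) (B j)‖ ≤ ‖A j‖ := fun j => by
      rw [hA, hB]; exact hXu (ψ j) t ht x
    have := le_of_tendsto_of_tendsto' (tendsto_const_nhds.mul hcr) hc.norm hle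
    rwa [ha, hb] at this
  -- every slice of `W` carries the enstrophy `m`
  have hZW : ∀ σ : ℝ, (∫ y, ‖lerayVorticity W (-σ) y‖ ^ 2) = m := by
    intro σ
    obtain ⟨c, hcdef⟩ : ∃ c : ℝ, c = Real.exp (σ / 2) := ⟨_, rfl⟩
    have hc : 0 < c := by rw [hcdef]; exact Real.exp_pos _
    have hlogc : 2 * Real.log c = σ := by rw [hcdef, Real.log_exp]; ring
    have hc2 : c ^ 2 * (-1) < 0 := by
      have : 0 < c ^ 2 := by positivity
      linarith
    obtain ⟨u', hu'def⟩ : ∃ u' : ℕ → ℝ → EuclideanSpace ℝ (Fin 3) → EuclideanSpace ℝ (Fin 3),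
        ∀ j, u' j = nsRescale c (u (ψ j)) := ⟨_, fun j => rfl⟩
    have hu' : ∀ j, IsTypeIAncientMild C (u' j) := fun j => by
      rw [hu'def]; exact (hu (ψ j)).nsRescale hc
    have hdu' : ∀ j, HasTypeIDecay C (u' j) := fun j => by
      rw [hu'def]; exact (hdu (ψ j)).nsRescale hc
    have hgr' : ∀ x, Tendsto (fun j => fderiv ℝ (u' j (-1)) x) atTop
        (𝓝 (fderiv ℝ (nsRescale c W (-1)) x)) := by
      intro x
      simp only [hu'def, fderiv_nsRescale]
      exact (hgr _ hc2 (c • x)).const_smul (c * c)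
    have hlim := tendsto_integral_sq_norm_curl_neg_one hu' hdu' hgr'
    -- identify the terms: `∫‖curl u'_j(−1)‖² = Z_V(−σ − 2ψ_j)` and `∫‖curl W'(−1)‖² = Z_W(−σ)`
    have e1 : ∀ j, (∫ x, ‖curl (u' j (-1)) x‖ ^ 2) = Z (-σ - 2 * (ψ j : ℝ)) := by
      intro j
      rw [← enstrophy_zero_eq, hu'def, enstrophy_nsRescale hc, hudef,
        enstrophy_nsRescale (Real.exp_pos _), Real.log_exp, hlogc, hZσ]
      congr 2
      ring
    have e2 : (∫ x, ‖curl (nsRescale c W (-1)) x‖ ^ 2) = ∫ y, ‖lerayVorticity W (-σ) y‖ ^ 2 := by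
      rw [← enstrophy_zero_eq, enstrophy_nsRescale hc, hlogc, zero_sub]
    rw [e2] at hlim
    simp_rw [e1] at hlim
    -- the receding slices converge to `m`
    have harg : Tendsto (fun j => -σ - 2 * (ψ j : ℝ)) atTop atBot := by
      have h2 : Tendsto (fun j => (-2) * (ψ j : ℝ)) atTop atBot :=
        hψt.const_mul_atTop_of_neg (by norm_num)
      have h3 := tendsto_atBot_add_const_left atTop (-σ) h2
      refine h3.congr fun j => ?_
      ring
    exact tendsto_nhds_unique hlim (hm.comp harg)
  have hZW' : ∀ s : ℝ, (∫ y, ‖lerayVorticity W s y‖ ^ 2) = m := fun s => by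
    have := hZW (-s); rwa [neg_neg] at this
  -- constant enstrophy is periodic: the limit vanishes, so `m = 0`
  have hW0 : ∀ t < 0, ∀ x, W t x = 0 :=
    eq_zero_of_crossFlow_le_one_of_enstrophy_periodic hW hdW (crossFlow_sim_of_phys hXW) one_pos
      fun s => by rw [hZW' (s + 1), hZW' s]
  have hm0 : m = 0 := by
    rw [← hZW' 0, enstrophy_zero_eq]
    have : W (-1) = fun _ => 0 := funext fun x => hW0 (-1) (by norm_num) x
    simp [this, curl_eq_curlCLM]
  -- hence `Z_V ≡ 0` and `V ≡ 0`
  have hZle : ∀ σ, Z σ ≤ m := fun σ => by rw [hmdef]; exact le_ciSup hbdd σ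
  have hΩ0 : ∀ s y, lerayVorticity V s y = 0 := by
    intro s
    have hcΩ : Continuous (lerayVorticity V s) := (contDiff_lerayVorticity_slice hV s).continuous
    have hE : ∫ y, ‖lerayVorticity V s y‖ ^ 2 = 0 := by
      have h1 := hZle s
      rw [hm0, hZσ] at h1
      exact le_antisymm h1 (integral_nonneg fun y => sq_nonneg _)
    have hae : (fun y => ‖lerayVorticity V s y‖ ^ 2) =ᵐ[volume] 0 :=
      (integral_eq_zero_iff_of_nonneg (fun y => sq_nonneg _)
        (integrable_norm_lerayVorticity_sq hV hD1 s)).1 hE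
    have hev : (fun y => ‖lerayVorticity V s y‖ ^ 2) = fun _ => (0 : ℝ) :=
      ((hcΩ.norm.pow 2).ae_eq_iff_eq (μ := volume) continuous_const).1 hae
    intro y
    have hy := congrFun hev y
    have : ‖lerayVorticity V s y‖ = 0 := pow_eq_zero_iff (n := 2) (by norm_num) |>.1 hy
    exact norm_eq_zero.1 this
  have hcurl : ∀ t < 0, ∀ x, curl (V t) x = 0 := by
    intro t ht x
    set s : ℝ := -Real.log (-t) with hs
    have hts : -Real.exp (-s) = t := by
      rw [hs, neg_neg, Real.exp_log (neg_pos.2 ht), neg_neg]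
    have h := hΩ0 s ((Real.exp (-s / 2))⁻¹ • x)
    rw [lerayVorticity_apply, curl_lerayOrbit, smul_smul,
      mul_inv_cancel₀ (Real.exp_pos _).ne', one_smul, hts, smul_eq_zero] at h
    exact h.resolve_left (Real.exp_pos _).ne'
  have hconstV : ∀ t < 0, ∀ x, V t x = V t 0 := fun t ht x =>
    eq_of_curl_eq_zero_of_isDivFree_of_bounded ((hV.contDiff_slice ht).of_le (by norm_cast))
      (hcurl t ht) (hV.isDivFree ht) (fun z => hV.norm_le ht z) x 0
  exact fun t ht x => hV.eq_zero_of_slice_const (b := fun t => V t 0) hconstV ht x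

/-- **Regularity form on the stratum**: an enveloped Type-I field of the class with cross-flow
`≤ 1` is NOT singular at the apex. -/
theorem not_singular_of_crossFlow_le_one (hV : IsTypeIAncientMild C V) (hdec : HasTypeIDecay C V)
    (hX : ∀ t < 0, ∀ x, Real.sqrt (-t) * ‖cross (curl (V t) x) (V t x)‖ ≤ ‖curl (V t) x‖) :
    ¬ (∀ r > 0, ∀ M : ℝ, ∃ t ∈ Set.Ioo (-(r ^ 2)) (0 : ℝ),
        ∃ x ∈ Metric.ball (0 : EuclideanSpace ℝ (Fin 3)) r, M < ‖V t x‖) := by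
  intro hsing
  obtain ⟨t, ht, x, -, hM⟩ := hsing 1 one_pos 0
  rw [eq_zero_of_crossFlow_le_one hV hdec hX t ht.2 x, norm_zero] at hM
  exact lt_irrefl _ hM

/-- **PORTRAIT: somewhere the flow crosses the vorticity strictly faster than the self-similar
speed.** A KNSS-gauge Type-I field with a Type-I envelope (constants equalised to `A ≥ C`) which is
SINGULAR at the apex has a point `(t, x)`, `t < 0`, with `‖curl W(t,x)‖ < √(−t)‖curl W(t,x) × W(t,x)‖`.
[folklore energy method + KNSS compactness] -/
theorem crossFlow_exceeds_of_singular {A : ℝ} (hV : IsTypeIAncientMild C V) (hCA : C ≤ A)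
    (hdec : HasTypeIDecay A V)
    (hsing : ∀ r > 0, ∀ M : ℝ, ∃ t ∈ Set.Ioo (-(r ^ 2)) (0 : ℝ),
        ∃ x ∈ Metric.ball (0 : EuclideanSpace ℝ (Fin 3)) r, M < ‖V t x‖) :
    ∃ t : ℝ, t < 0 ∧ ∃ x : EuclideanSpace ℝ (Fin 3),
      ‖curl (V t) x‖ < Real.sqrt (-t) * ‖cross (curl (V t) x) (V t x)‖ := by
  by_contra h
  push Not at h
  exact not_singular_of_crossFlow_le_one (isTypeIAncientMild_of_le hV hCA) hdec h hsing

end Threshold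

end Summit.NavierStokesRegularity.NavierStokesRegularity.Theorems.FiniteDissipationLiouville.CrossFlow

end
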